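import Literature.AnabelianGeometry.EtaleTheta.ThetaSubquotientOfTemperedGalois

/-!
# [EtTh] §5: theta subquotients over `B^temp(Π)⁰` — comparison with print's subquotient of `Aut`

Mochizuki, *The étale theta function and its Frobenioid-theoretic manifestations*, Publ. RIMS **45**
(2009), §5 p. 327 (PDF p. 101) [cite: MochizukiEtTh2009, §5 p.327 (PDF p.101)]: "these subquotients
determine subquotients `Aut_D(D) ↠ Aut^Θ_D(D)`; `(l·Δ_Θ)_D ⊆ Aut^Θ_D(D)`".  abc-iut cell, layer L2, seat
abc-iut-L2-t9 (unit W2-L2-05; companion to `ThetaSubquotientOfTempered{,Galois}.lean`, reading R2 of the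
§5 owner abc-iut-L2-t4, who asked that the relation to print's subquotient-of-`Aut` be made explicit).

Print's object at `E ∈ Ob(B^temp(Π)⁰)`: the automorphisms `σ ∈ Aut_D(E)` that are "given by `l·Δ_Θ`", i.e.
act at every point as an element `n ∈ Π` with `q(n) ∈ L = ι(Λ)` (`autPre E ⊆ Aut E`), modulo those acting by
elements of `q⁻¹(q(Stab))`-type.  This file constructs

* `autPre q ι E : Subgroup (Aut E)` and the CANONICAL HOMOMORPHISM `autProj : autPre E →* (l·Δ_Θ)_E`
  (`σ ↦` the family `x ↦ [q(n_x)]`, `σ(x) = n_x · x`; independent of the choice of `n_x`, `autProj_evalAt`),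
  whose image is print's `(l·Δ_Θ)_E` viewed inside the carrier of `ThetaSubquotientOfTempered.lean`;
* **at a Galois object** (a point with NORMAL stabiliser, `q` surjective) `autProj` is SURJECTIVE
  (`autProj_surjective_of_normal`): every class is realised by an automorphism `g·x ↦ g·n·x`
  (`exists_aut_apply_eq`), so there the carrier IS print's subquotient of `Aut_D(E) = Π/N` — the objects
  at which
  §5 evaluates `(l·Δ_Θ)_(−)`.

HONEST FRAMING: at non-Galois objects `autProj` need not be surjective (the carrier is the coinvariant
enlargement); nothing is asserted about [EtTh]'s curves.
-/

noncomputable section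

namespace Literature.AnabelianGeometry.EtaleTheta

namespace ThetaSubquotient

open CategoryTheory Literature.AlgebraicGeometry.Frobenioids Literature.AnabelianGeometry.SemiGraphs
open Literature.AlgebraicGeometry.Frobenioids.QuasiTemperoid (stabilizerSubgroup)
open Literature.AlgebraicGeometry.Frobenioids.QuasiTemperoid.BTempConnected (hom_ρ ρ_mul_apply
  ρ_one_apply ρ_inv_apply ρ_apply_inv exists_ρ_eq_of_isConnectedObj hom_eq_of_apply_eq
  exists_hom_of_stabilizer_le)

universe u v w

variable {G : Type u} [Group G] [TopologicalSpace G] {Q : Type v} [Group Q] {Λ : Type w}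
  [CommGroup Λ] (q : G →* Q) (ι : Λ →* Q)

/-! ### Automorphisms acting through `q⁻¹(L)` -/

section AutPre

variable (E : BTemp G)

/-- Composition in `Aut E` on points: `(σ * τ)(x) = σ(τ(x))`.
[cite: MochizukiEtTh2009, §5 p.327 (PDF p.101)] -/
theorem aut_mul_apply (σ τ : Aut E) (x : E.obj.V) :
    ((σ * τ).hom.hom.hom x : E.obj.V) = σ.hom.hom.hom (τ.hom.hom.hom x) := rfl

/-- `(1 : Aut E)(x) = x`. [cite: MochizukiEtTh2009, §5 p.327 (PDF p.101)] -/
theorem aut_one_apply (x : E.obj.V) : ((1 : Aut E).hom.hom.hom x : E.obj.V) = x := rfl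

/-- `σ⁻¹ (σ x) = x`. [cite: MochizukiEtTh2009, §5 p.327 (PDF p.101)] -/
theorem aut_inv_apply_apply (σ : Aut E) (x : E.obj.V) :
    (σ⁻¹.hom.hom.hom (σ.hom.hom.hom x) : E.obj.V) = x := by
  rw [← aut_mul_apply, inv_mul_cancel, aut_one_apply]

/-- **Print's automorphisms "given by `l·Δ_Θ`"**: `σ ∈ Aut_D(E)` acting at every point as some `n ∈ Π` with
`q(n) ∈ L` (for connected `E ≅ Π/S`: the image of `N_Π(S) ∩ q⁻¹(L·q(S))` in `Aut_D(E) = N_Π(S)/S`).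
[cite: MochizukiEtTh2009, §5 p.327 (PDF p.101)] -/
def autPre : Subgroup (Aut E) where
  carrier := {σ | ∀ x : E.obj.V, ∃ n : G, q n ∈ ι.range ∧ (σ.hom.hom.hom x : E.obj.V) = E.obj.ρ n x}
  one_mem' x := ⟨1, by simp, by rw [aut_one_apply, ρ_one_apply]⟩
  mul_mem' {σ τ} hσ hτ x := by
    obtain ⟨m, hm, hτx⟩ := hτ x
    obtain ⟨n, hn, hσx⟩ := hσ x
    refine ⟨m * n, by rw [map_mul]; exact ι.range.mul_mem hm hn, ?_⟩
    rw [aut_mul_apply, hτx, hom_ρ, hσx, ρ_mul_apply]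
  inv_mem' {σ} hσ x := by
    obtain ⟨n, hn, hσx⟩ := hσ x
    refine ⟨n⁻¹, by rw [map_inv]; exact ι.range.inv_mem hn, ?_⟩
    have h : (σ⁻¹.hom.hom.hom (E.obj.ρ n x) : E.obj.V) = x := by rw [← hσx, aut_inv_apply_apply]
    rw [hom_ρ] at h
    have h2 := congrArg (E.obj.ρ n⁻¹) h
    rwa [ρ_inv_apply] at h2

/-- Membership in `autPre`. [cite: MochizukiEtTh2009, §5 p.327 (PDF p.101)] -/
theorem mem_autPre_iff {σ : Aut E} : σ ∈ autPre q ι E ↔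
    ∀ x : E.obj.V, ∃ n : G, q n ∈ ι.range ∧ (σ.hom.hom.hom x : E.obj.V) = E.obj.ρ n x := Iff.rfl

variable [ι.range.Normal]

/-- A choice of `n_x ∈ Π` with `σ(x) = n_x·x`, `q(n_x) = ι(λ_x)`, for `σ ∈ autPre E`: the resulting function
`x ↦ λ_x` is a compatible family. [cite: MochizukiEtTh2009, §5 p.327 (PDF p.101)] -/
theorem exists_fam_of_mem_autPre {σ : Aut E} (hσ : σ ∈ autPre q ι E) :
    ∃ t ∈ Fam q ι E, ∀ x, ∃ n : G, q n = ι (t x) ∧ (σ.hom.hom.hom x : E.obj.V) = E.obj.ρ n x := by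
  choose n hn hσn using hσ
  have hl : ∀ x, ∃ a : Λ, ι a = q (n x) := fun x => by
    obtain ⟨a, ha⟩ := hn x
    exact ⟨a, ha⟩
  choose t ht using hl
  refine ⟨t, ?_, fun x => ⟨n x, (ht x).symm, hσn x⟩⟩
  intro g x
  rw [ht, ht]
  -- `n_{g·x}` and `g n_x g⁻¹` both carry `g·x` to `σ(g·x)`
  have hs : (n (E.obj.ρ g x))⁻¹ * (g * n x * g⁻¹) ∈ stabilizerSubgroup E (E.obj.ρ g x) := by
    change E.obj.ρ ((n (E.obj.ρ g x))⁻¹ * (g * n x * g⁻¹)) (E.obj.ρ g x) = E.obj.ρ g x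
    have h1 : (σ.hom.hom.hom (E.obj.ρ g x) : E.obj.V) = E.obj.ρ (g * n x * g⁻¹) (E.obj.ρ g x) := by
      rw [hom_ρ, hσn, ρ_mul_apply, ρ_mul_apply, ρ_inv_apply]
    rw [ρ_mul_apply, ← h1, hσn, ρ_inv_apply]
  refine mem_killQ_of_mem_map q ι ?_ ?_
  · have := Subgroup.mem_map_of_mem q hs
    simpa only [map_mul, map_inv] using this
  · exact ι.range.mul_mem (ι.range.inv_mem ⟨_, (ht _)⟩) (conj_mem_range' q ι g (n x) (hn x))
where
  /-- conjugates of elements of `L` lie in `L` -/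
  conj_mem_range' (q : G →* Q) (ι : Λ →* Q) [h : ι.range.Normal] (g n : G) (hn : q n ∈ ι.range) :
      q g * q n * (q g)⁻¹ ∈ ι.range := h.conj_mem _ hn _

/-- **The canonical homomorphism `autPre E → (l·Δ_Θ)_E`**, `σ ↦ (x ↦ [q(n_x)])` — print's subquotient of
`Aut_D(E)` mapping into the carrier. [cite: MochizukiEtTh2009, §5 p.327 (PDF p.101)] -/
def autProj : autPre q ι E →* LDelta q ι E where
  toFun σ := mk q ι E ⟨_, (Classical.choose_spec (exists_fam_of_mem_autPre q ι E σ.2)).1⟩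
  map_one' := by
    rw [← QuotientGroup.mk_one, mk_eq_mk_iff]
    intro x
    obtain ⟨n, hn, h1⟩ :=
      (Classical.choose_spec (exists_fam_of_mem_autPre q ι E (1 : autPre q ι E).2)).2 x
    change ((1 : Aut E).hom.hom.hom x : E.obj.V) = E.obj.ρ n x at h1
    rw [aut_one_apply] at h1
    have hs : n ∈ stabilizerSubgroup E x := h1.symm
    simp only [Subgroup.coe_one, Pi.one_apply, map_one, mul_one]
    refine (killQ q ι _).inv_mem (mem_killQ_of_mem_map q ι ?_ ?_)
    · rw [← hn]; exact Subgroup.mem_map_of_mem q hs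
    · exact mem_range_self ι _
  map_mul' σ τ := by
    rw [← QuotientGroup.mk_mul, mk_eq_mk_iff]
    intro x
    obtain ⟨nst, hnst, hst⟩ := (Classical.choose_spec (exists_fam_of_mem_autPre q ι E (σ * τ).2)).2 x
    obtain ⟨ns, hns, hs⟩ := (Classical.choose_spec (exists_fam_of_mem_autPre q ι E σ.2)).2 x
    obtain ⟨nt, hnt, ht⟩ := (Classical.choose_spec (exists_fam_of_mem_autPre q ι E τ.2)).2 x
    change (((σ : Aut E) * τ).hom.hom.hom x : E.obj.V) = _ at hst
    rw [aut_mul_apply] at hst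
    change ((τ : Aut E).hom.hom.hom x : E.obj.V) = _ at ht
    change ((σ : Aut E).hom.hom.hom x : E.obj.V) = _ at hs
    rw [ht, hom_ρ, hs, ← ρ_mul_apply] at hst
    -- `nst⁻¹ (nt ns) ∈ Stab x`
    have hstab : nst⁻¹ * (nt * ns) ∈ stabilizerSubgroup E x := by
      change E.obj.ρ (nst⁻¹ * (nt * ns)) x = x
      rw [ρ_mul_apply, hst, ρ_inv_apply]
    simp only [Subgroup.coe_mul, Pi.mul_apply, map_mul]
    rw [← hnst, ← hns, ← hnt]
    have comm : q ns * q nt = q nt * q ns :=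
      range_comm ι (hns ▸ mem_range_self ι _) (hnt ▸ mem_range_self ι _)
    rw [comm, ← map_mul, ← map_inv, ← map_mul]
    refine mem_killQ_of_mem_map q ι (Subgroup.mem_map_of_mem q hstab) ?_
    rw [map_mul, map_inv, map_mul, hnst, hns, hnt]
    exact ι.range.mul_mem (ι.range.inv_mem (mem_range_self ι _))
      (ι.range.mul_mem (mem_range_self ι _) (mem_range_self ι _))

/-- **`autProj` is independent of choices**: if `σ(x) = n·x` with `ι(a) = q(n)`, then the class of
`autProj σ` at `x` is `[a]`. [cite: MochizukiEtTh2009, §5 p.327 (PDF p.101)] -/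
theorem evalAt_autProj (σ : autPre q ι E) (x : E.obj.V) (n : G) (a : Λ) (ha : ι a = q n)
    (hσ : ((σ : Aut E).hom.hom.hom x : E.obj.V) = E.obj.ρ n x) :
    evalAt q ι E x (autProj q ι E σ) = QuotientGroup.mk a := by
  change evalAt q ι E x (mk q ι E _) = _
  rw [evalAt_mk, QuotientGroup.eq, Subgroup.mem_comap, map_mul, map_inv]
  obtain ⟨n', hn', h'⟩ := (Classical.choose_spec (exists_fam_of_mem_autPre q ι E σ.2)).2 x
  change ((σ : Aut E).hom.hom.hom x : E.obj.V) = _ at h'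
  have hstab : n'⁻¹ * n ∈ stabilizerSubgroup E x := by
    change E.obj.ρ (n'⁻¹ * n) x = x
    rw [ρ_mul_apply, ← hσ, h', ρ_inv_apply]
  rw [← hn', ha, ← map_inv, ← map_mul]
  refine mem_killQ_of_mem_map q ι (Subgroup.mem_map_of_mem q hstab) ?_
  rw [map_mul, map_inv, hn', ← ha]
  exact ι.range.mul_mem (ι.range.inv_mem (mem_range_self ι _)) (mem_range_self ι _)

end AutPre

/-! ### Galois objects: every class comes from an automorphism -/

section Galois

variable {E : BTemp G}

/-- For a point `x` with NORMAL stabiliser `N`, every `n ∈ Π` induces the automorphism `g·x ↦ g·n·x` of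
the connected object `E ≅ Π/N` (right multiplication by `n` on `Π/N`).
[cite: MochizukiEtTh2009, §5 p.327 (PDF p.101)] -/
theorem exists_aut_apply_eq (hE : IsConnectedObj E) (x : E.obj.V) (hN : (stabilizerSubgroup E x).Normal)
    (n : G) :
    ∃ σ : Aut E, (σ.hom.hom.hom x : E.obj.V) = E.obj.ρ n x := by
  have htr := exists_ρ_eq_of_isConnectedObj E hE x
  have hle : ∀ m : G, ∀ g : G, E.obj.ρ g x = x → E.obj.ρ g (E.obj.ρ m x) = E.obj.ρ m x := by
    intro m g hg
    have h : m⁻¹ * g * m ∈ stabilizerSubgroup E x := by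
      have := hN.conj_mem g hg m⁻¹
      rwa [inv_inv] at this
    change E.obj.ρ (m⁻¹ * g * m) x = x at h
    rw [ρ_mul_apply, ρ_mul_apply] at h
    have h' := congrArg (E.obj.ρ m) h
    rwa [ρ_apply_inv] at h'
  obtain ⟨f, hf⟩ := exists_hom_of_stabilizer_le x htr (E.obj.ρ n x) (hle n)
  obtain ⟨f', hf'⟩ := exists_hom_of_stabilizer_le x htr (E.obj.ρ n⁻¹ x) (hle n⁻¹)
  have h1 : f ≫ f' = 𝟙 E := by
    refine hom_eq_of_apply_eq hE _ _ x ?_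
    change (f'.hom.hom (f.hom.hom x) : E.obj.V) = x
    rw [hf, hom_ρ, hf', ρ_apply_inv]
  have h2 : f' ≫ f = 𝟙 E := by
    refine hom_eq_of_apply_eq hE _ _ x ?_
    change (f.hom.hom (f'.hom.hom x) : E.obj.V) = x
    rw [hf', hom_ρ, hf, ρ_inv_apply]
  exact ⟨⟨f, f', h1, h2⟩, hf⟩

variable [ι.range.Normal]

/-- The automorphism of `exists_aut_apply_eq` lies in `autPre` when `q(n) ∈ L` (it acts at `g·x` by
`g n g⁻¹`, and `L` is normal). [cite: MochizukiEtTh2009, §5 p.327 (PDF p.101)] -/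
theorem mem_autPre_of_apply_eq (hE : IsConnectedObj E) (x : E.obj.V) {n : G} (hn : q n ∈ ι.range)
    {σ : Aut E} (hσ : (σ.hom.hom.hom x : E.obj.V) = E.obj.ρ n x) : σ ∈ autPre q ι E := by
  intro x'
  obtain ⟨g, rfl⟩ := exists_ρ_eq_of_isConnectedObj E hE x x'
  refine ⟨g * n * g⁻¹, ?_, ?_⟩
  · rw [map_mul, map_mul, map_inv]
    exact Subgroup.Normal.conj_mem inferInstance _ hn _
  · rw [hom_ρ, hσ, ρ_mul_apply, ρ_mul_apply, ρ_inv_apply]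

/-- **At a Galois object `autProj` is surjective**: for a point `x` with normal stabiliser and `q`
surjective, every element of `(l·Δ_Θ)_E` is the image of an automorphism of `E` "given by `l·Δ_Θ`" — there
the carrier is exactly print's subquotient of `Aut_D(E)`. [cite: MochizukiEtTh2009, §5 p.327 (PDF p.101)] -/
theorem autProj_surjective_of_normal (hE : IsConnectedObj E) (hq : Function.Surjective q)
    (x : E.obj.V) (hN : (stabilizerSubgroup E x).Normal) :
    Function.Surjective (autProj q ι E) := by
  intro c
  obtain ⟨c₀, rfl⟩ := (evalEquiv q ι hE x).symm.surjective c
  induction c₀ using QuotientGroup.induction_on with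
  | H a =>
    obtain ⟨n, hn⟩ := hq (ι a)
    obtain ⟨σ, hσ⟩ := exists_aut_apply_eq hE x hN n
    have hmem : σ ∈ autPre q ι E := mem_autPre_of_apply_eq q ι hE x (hn ▸ mem_range_self ι a) hσ
    refine ⟨⟨σ, hmem⟩, ?_⟩
    apply (evalEquiv q ι hE x).injective
    rw [MulEquiv.apply_symm_apply, evalEquiv_apply]
    exact evalAt_autProj q ι E ⟨σ, hmem⟩ x n a hn.symm hσ

end Galois

end ThetaSubquotient

end Literature.AnabelianGeometry.EtaleTheta

end
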